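import Summits.QuantumFields.YangMills.Theorems.BalabanLadderIRColdPurityBridge
import Literature.MathematicalPhysics.QuantumFieldTheory.FiniteGaugeGroupTorus
import HarnessLib

/-!
# THE NUMBER's currency at `β → ∞`, fixed box: the FREEZING LIMIT of the cold purity defect (helper for stmt-QuantumFields-26930 `IRcof`)

Helper file (`--supports stmt-QuantumFields-26930`; LEAD prover `ymfull-r2c-lead-1` g0, cell `ym-gapexp`, director-ym R590 item (8):
«BC5 witness side ∕ toy-rung theorems under `Theorems/IR/`»).  The registered stub `stub_pinnedExitsCofinal : PinnedExitsCofinalAt (1/24)` of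
`Cruxes/IRcof/Lines/pinned_cofinal_bill.lean` (THE NUMBER, cofinal) is a statement about the cold period-doubling defect
`coldDefect ρ β L = 1 − Z_β(L³×2⌊L/4⌋) / Z_β(L³×⌊L/4⌋)²` (`ColdPurityBridge.coldDefect`, `Z = wilsonFinTorusPartition`) along `β → ∞` with the
box pinned in floor units.  This file records, kernel-checked and for EVERY compact gauge group `G` (second countable) and every continuous
matrix representation `ρ`, what the currency does at a FIXED box as `β → ∞`:

* `tendsto_wilsonFinTorusPartition_atTop` — **freezing of the partition function**: `Z_β(n₀,n₁,n₂,n₃) → Haar(Flat)` as `β → ∞`, where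
  `Flat` is the set of lattice gauge fields all of whose plaquettes have maximal character `Re tr ρ(U_p) = n` (dominated convergence: the
  Wilson weight `exp(−β Σ_p (n − Re tr ρ(U_p)))` is `≤ 1` for `β ≥ 0` and tends pointwise to the indicator of `Flat`);
* `tendsto_coldDefect_atTop` — hence, whenever the flat set of the short box `L³×⌊L/4⌋` has positive Haar mass,
  **`coldDefect ρ β L → 1 − Haar(Flat(L³×2⌊L/4⌋)) / Haar(Flat(L³×⌊L/4⌋))²`**: at a fixed box THE NUMBER's `β = ∞` endpoint is a ratio of
  flat-connection volumes ('t Hooft flux-sector counting), blind to everything the stub is about;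
* `eventually_lt_coldDefect_of_lt_freezingLimit` — the fixed-box purity test at tolerance `θ` FAILS for all large `β` as soon as
  `θ < 1 − Haar(Flat₂)/Haar(Flat₁)²` (the form consumed by finite-group witnesses: for a finite abelian `G` the right-hand side is
  `1 − |G|⁻³`, the finite-group extreme of the card's sentence «at `π₁(G) ≠ 1`, `δᶜ → 1 − |π₁|⁻³`» — counted in a companion file).

For a connected compact Lie group of positive dimension the flat set is Haar-null, `Z_β → 0` on every box, and THE NUMBER at a fixed box is
the `0/0` energy–entropy competition this limit does not see: the file is CALIBRATION of the currency (BC5 side), not movement on the stub.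
HONEST FRAMING: finite-volume bookkeeping; nothing here proves `PinnedExitsCofinalAt`, `IRcof`, `IR`, or the Yang–Mills mass gap (Clay);
R4 closes only the conditional finite-𝕋⁴ rung `BalabanLadder.UV`.  Def-free (sets written inline).
References: G. 't Hooft, Nucl. Phys. B153 (1979) 141 (flux sectors on the torus); I. Montvay, G. Münster, *Quantum Fields on a Lattice*
(1994) §3.2.6 (3.145) (`Z = tr 𝕋ⁿ`); tree `WilsonFinTorusPartition.lean`, `BalabanLadderIRColdPurityBridge.lean`.
-/

set_option autoImplicit false

noncomputable section

open Filter Topology MeasureTheory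
open Literature.MathematicalPhysics.QuantumFieldTheory Literature.MathematicalPhysics.QuantumLattice
open Summit.QuantumFields.YangMills.Cruxes.IR.ColdPurityBridge (coldDefect)

namespace Summit.QuantumFields.YangMills.Cruxes.IR.FreezingLimit

variable {G : Type} [Group G] [TopologicalSpace G] [IsTopologicalGroup G] [CompactSpace G]
  [MeasurableSpace G] [BorelSpace G] [SecondCountableTopology G]
variable {n : ℕ} (ρ : G →* Matrix (Fin n) (Fin n) ℂ)

/-! ## §1 The Wilson weight: non-negative action, bounded weight, pointwise freezing -/

omit [MeasurableSpace G] [BorelSpace G] [SecondCountableTopology G] in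
/-- Each plaquette term `n − Re tr ρ(g)` of Wilson's action is non-negative (continuous representation of a compact group:
`|Re tr ρ(g)| ≤ n`, tree `CompactGroup.abs_re_trace_le_card`). -/
theorem sub_re_trace_nonneg (hρ : Continuous ρ) (g : G) : 0 ≤ (n : ℝ) - (ρ g).trace.re := by
  have h := Literature.RepresentationTheory.CompactGroups.CompactGroup.abs_re_trace_le_card ρ hρ g
  rw [Fintype.card_fin] at h
  linarith [(abs_le.1 h).2]

omit [MeasurableSpace G] [BorelSpace G] [SecondCountableTopology G] in
/-- The total Wilson action of the `Fin`-torus `n₀ × n₁ × n₂ × n₃` is non-negative. -/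
theorem action_nonneg (hρ : Continuous ρ) {n₀ n₁ n₂ n₃ : ℕ} (U : FinTorusSite n₀ n₁ n₂ n₃ × Fin 4 → G) :
    0 ≤ ∑ x : FinTorusSite n₀ n₁ n₂ n₃, ∑ q : {q : Fin 4 × Fin 4 // q.1 < q.2},
      ((n : ℝ) - (ρ (finTorusPlaquette U x q.1.1 q.1.2)).trace.re) :=
  Finset.sum_nonneg fun _ _ => Finset.sum_nonneg fun _ _ => sub_re_trace_nonneg ρ hρ _

omit [MeasurableSpace G] [BorelSpace G] [SecondCountableTopology G] in
/-- The total Wilson action vanishes exactly on the FLAT set (every plaquette has maximal character `Re tr ρ(U_p) = n`). -/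
theorem action_eq_zero_iff (hρ : Continuous ρ) {n₀ n₁ n₂ n₃ : ℕ} (U : FinTorusSite n₀ n₁ n₂ n₃ × Fin 4 → G) :
    (∑ x : FinTorusSite n₀ n₁ n₂ n₃, ∑ q : {q : Fin 4 × Fin 4 // q.1 < q.2},
      ((n : ℝ) - (ρ (finTorusPlaquette U x q.1.1 q.1.2)).trace.re)) = 0 ↔
    U ∈ {U : FinTorusSite n₀ n₁ n₂ n₃ × Fin 4 → G |
      ∀ (x : FinTorusSite n₀ n₁ n₂ n₃) (q : {q : Fin 4 × Fin 4 // q.1 < q.2}),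
        (ρ (finTorusPlaquette U x q.1.1 q.1.2)).trace.re = n} := by
  rw [Finset.sum_eq_zero_iff_of_nonneg fun x _ => Finset.sum_nonneg fun q _ => sub_re_trace_nonneg ρ hρ _]
  simp only [Finset.mem_univ, forall_true_left, Set.mem_setOf_eq]
  refine forall_congr' fun x => ?_
  rw [Finset.sum_eq_zero_iff_of_nonneg fun q _ => sub_re_trace_nonneg ρ hρ _]
  simp only [Finset.mem_univ, forall_true_left, sub_eq_zero]
  exact forall_congr' fun q => eq_comm

omit [CompactSpace G] [MeasurableSpace G] [BorelSpace G] [SecondCountableTopology G] in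
/-- The Wilson weight `exp(−β S(U))` is continuous in the gauge field. -/
theorem continuous_weight (hρ : Continuous ρ) (β : ℝ) (n₀ n₁ n₂ n₃ : ℕ) :
    Continuous fun U : FinTorusSite n₀ n₁ n₂ n₃ × Fin 4 → G =>
      Real.exp (-β * ∑ x : FinTorusSite n₀ n₁ n₂ n₃, ∑ q : {q : Fin 4 × Fin 4 // q.1 < q.2},
        ((n : ℝ) - (ρ (finTorusPlaquette U x q.1.1 q.1.2)).trace.re)) := by
  have hU : ∀ l : FinTorusSite n₀ n₁ n₂ n₃ × Fin 4,
      Continuous fun U : FinTorusSite n₀ n₁ n₂ n₃ × Fin 4 → G => U l := fun l => continuous_apply l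
  have hpl : ∀ (x : FinTorusSite n₀ n₁ n₂ n₃) (μ ν : Fin 4),
      Continuous fun U : FinTorusSite n₀ n₁ n₂ n₃ × Fin 4 → G => finTorusPlaquette U x μ ν := fun x μ ν =>
    (((hU _).mul (hU _)).mul (hU _).inv).mul (hU _).inv
  have htr : Continuous fun g : G => (ρ g).trace.re := Complex.continuous_re.comp (Continuous.matrix_trace hρ)
  exact Real.continuous_exp.comp (continuous_const.mul (continuous_finsetSum _ fun x _ =>
    continuous_finsetSum _ fun q _ => continuous_const.sub (htr.comp (hpl x _ _))))

omit [MeasurableSpace G] [BorelSpace G] [SecondCountableTopology G] in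
/-- For `β ≥ 0` the Wilson weight is at most `1`. -/
theorem weight_le_one (hρ : Continuous ρ) {β : ℝ} (hβ : 0 ≤ β) {n₀ n₁ n₂ n₃ : ℕ}
    (U : FinTorusSite n₀ n₁ n₂ n₃ × Fin 4 → G) :
    Real.exp (-β * ∑ x : FinTorusSite n₀ n₁ n₂ n₃, ∑ q : {q : Fin 4 × Fin 4 // q.1 < q.2},
        ((n : ℝ) - (ρ (finTorusPlaquette U x q.1.1 q.1.2)).trace.re)) ≤ 1 := by
  rw [Real.exp_le_one_iff, neg_mul, neg_nonpos]
  exact mul_nonneg hβ (action_nonneg ρ hρ U)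

omit [MeasurableSpace G] [BorelSpace G] [SecondCountableTopology G] in
/-- **Pointwise freezing.**  As `β → ∞` the Wilson weight of a fixed gauge field tends to the indicator of the flat set. -/
theorem tendsto_weight_atTop (hρ : Continuous ρ) {n₀ n₁ n₂ n₃ : ℕ} (U : FinTorusSite n₀ n₁ n₂ n₃ × Fin 4 → G) :
    Tendsto (fun β : ℝ => Real.exp (-β * ∑ x : FinTorusSite n₀ n₁ n₂ n₃, ∑ q : {q : Fin 4 × Fin 4 // q.1 < q.2},
        ((n : ℝ) - (ρ (finTorusPlaquette U x q.1.1 q.1.2)).trace.re))) atTop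
      (𝓝 ({U : FinTorusSite n₀ n₁ n₂ n₃ × Fin 4 → G |
        ∀ (x : FinTorusSite n₀ n₁ n₂ n₃) (q : {q : Fin 4 × Fin 4 // q.1 < q.2}),
          (ρ (finTorusPlaquette U x q.1.1 q.1.2)).trace.re = n}.indicator 1 U)) := by
  set S : ℝ := ∑ x : FinTorusSite n₀ n₁ n₂ n₃, ∑ q : {q : Fin 4 × Fin 4 // q.1 < q.2},
        ((n : ℝ) - (ρ (finTorusPlaquette U x q.1.1 q.1.2)).trace.re) with hS
  by_cases hU : U ∈ {U : FinTorusSite n₀ n₁ n₂ n₃ × Fin 4 → G |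
        ∀ (x : FinTorusSite n₀ n₁ n₂ n₃) (q : {q : Fin 4 × Fin 4 // q.1 < q.2}),
          (ρ (finTorusPlaquette U x q.1.1 q.1.2)).trace.re = n}
  · have h0 : S = 0 := (action_eq_zero_iff ρ hρ U).2 hU
    rw [Set.indicator_of_mem hU]
    simp only [h0, mul_zero, Real.exp_zero, Pi.one_apply]
    exact tendsto_const_nhds
  · have hpos : 0 < S := lt_of_le_of_ne (action_nonneg ρ hρ U) (fun h => hU ((action_eq_zero_iff ρ hρ U).1 h.symm))
    rw [Set.indicator_of_notMem hU]
    have h1 : Tendsto (fun β : ℝ => β * S) atTop atTop := tendsto_id.atTop_mul_const hpos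
    have h2 := Real.tendsto_exp_atBot.comp (tendsto_neg_atTop_atBot.comp h1)
    refine h2.congr fun β => ?_
    simp only [Function.comp_apply, neg_mul]

/-! ## §2 Freezing of the partition function and of the cold purity defect -/

omit [CompactSpace G] in
/-- The flat set is closed, hence Borel measurable in the product configuration space. -/
theorem measurableSet_flat (hρ : Continuous ρ) (n₀ n₁ n₂ n₃ : ℕ) :
    MeasurableSet {U : FinTorusSite n₀ n₁ n₂ n₃ × Fin 4 → G |
      ∀ (x : FinTorusSite n₀ n₁ n₂ n₃) (q : {q : Fin 4 × Fin 4 // q.1 < q.2}),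
        (ρ (finTorusPlaquette U x q.1.1 q.1.2)).trace.re = n} := by
  have hU : ∀ l : FinTorusSite n₀ n₁ n₂ n₃ × Fin 4,
      Continuous fun U : FinTorusSite n₀ n₁ n₂ n₃ × Fin 4 → G => U l := fun l => continuous_apply l
  have hpl : ∀ (x : FinTorusSite n₀ n₁ n₂ n₃) (μ ν : Fin 4),
      Continuous fun U : FinTorusSite n₀ n₁ n₂ n₃ × Fin 4 → G => finTorusPlaquette U x μ ν := fun x μ ν =>
    (((hU _).mul (hU _)).mul (hU _).inv).mul (hU _).inv
  have htr : Continuous fun g : G => (ρ g).trace.re := Complex.continuous_re.comp (Continuous.matrix_trace hρ)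
  have hset : {U : FinTorusSite n₀ n₁ n₂ n₃ × Fin 4 → G |
      ∀ (x : FinTorusSite n₀ n₁ n₂ n₃) (q : {q : Fin 4 × Fin 4 // q.1 < q.2}),
        (ρ (finTorusPlaquette U x q.1.1 q.1.2)).trace.re = n} =
      ⋂ (x : FinTorusSite n₀ n₁ n₂ n₃), ⋂ (q : {q : Fin 4 × Fin 4 // q.1 < q.2}),
        (fun U : FinTorusSite n₀ n₁ n₂ n₃ × Fin 4 → G => (ρ (finTorusPlaquette U x q.1.1 q.1.2)).trace.re) ⁻¹' {(n : ℝ)} := by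
    ext U; simp only [Set.mem_setOf_eq, Set.mem_iInter, Set.mem_preimage, Set.mem_singleton_iff]
  rw [hset]
  exact (isClosed_iInter fun x => isClosed_iInter fun q =>
    isClosed_singleton.preimage (htr.comp (hpl x _ _))).measurableSet

/-- **FREEZING OF THE PARTITION FUNCTION.**  For every compact (second countable) gauge group `G` and every continuous matrix
representation `ρ`: `Z_β(n₀,n₁,n₂,n₃) → Haar(Flat)` as `β → ∞` — the product-Haar mass of the gauge fields all of whose plaquettes have
maximal character.  Dominated convergence (weight `≤ 1` for `β ≥ 0`, pointwise freezing `tendsto_weight_atTop`). -/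
theorem tendsto_wilsonFinTorusPartition_atTop (hρ : Continuous ρ) (n₀ n₁ n₂ n₃ : ℕ) :
    Tendsto (fun β : ℝ => wilsonFinTorusPartition ρ β n₀ n₁ n₂ n₃) atTop
      (𝓝 ((Measure.pi fun _ : FinTorusSite n₀ n₁ n₂ n₃ × Fin 4 => haarProbability G).real
        {U : FinTorusSite n₀ n₁ n₂ n₃ × Fin 4 → G |
          ∀ (x : FinTorusSite n₀ n₁ n₂ n₃) (q : {q : Fin 4 × Fin 4 // q.1 < q.2}),
            (ρ (finTorusPlaquette U x q.1.1 q.1.2)).trace.re = n})) := by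
  set π : Measure (FinTorusSite n₀ n₁ n₂ n₃ × Fin 4 → G) :=
    Measure.pi fun _ : FinTorusSite n₀ n₁ n₂ n₃ × Fin 4 => haarProbability G with hπ
  rw [← integral_indicator_one (measurableSet_flat ρ hρ n₀ n₁ n₂ n₃)]
  unfold wilsonFinTorusPartition
  refine tendsto_integral_filter_of_dominated_convergence (fun _ => (1 : ℝ)) ?_ ?_ (integrable_const 1) ?_
  · exact Eventually.of_forall fun β => (continuous_weight ρ hρ β n₀ n₁ n₂ n₃).aestronglyMeasurable
  · filter_upwards [eventually_ge_atTop (0 : ℝ)] with β hβ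
    refine Eventually.of_forall fun U => ?_
    rw [Real.norm_of_nonneg (Real.exp_nonneg _)]
    exact weight_le_one ρ hρ hβ U
  · exact Eventually.of_forall fun U => tendsto_weight_atTop ρ hρ U

/-- **FREEZING OF THE COLD PURITY DEFECT (THE NUMBER's currency at a fixed box, `β → ∞`).**  If the flat set of the short cold box
`L³ × ⌊L/4⌋` has positive product-Haar mass, then
`coldDefect ρ β L → 1 − Haar(Flat(L³×2⌊L/4⌋)) / Haar(Flat(L³×⌊L/4⌋))²` as `β → ∞`. -/
theorem tendsto_coldDefect_atTop (hρ : Continuous ρ) (L : ℕ)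
    (hpos : (Measure.pi fun _ : FinTorusSite L L L (L / 4) × Fin 4 => haarProbability G).real
        {U : FinTorusSite L L L (L / 4) × Fin 4 → G |
          ∀ (x : FinTorusSite L L L (L / 4)) (q : {q : Fin 4 × Fin 4 // q.1 < q.2}),
            (ρ (finTorusPlaquette U x q.1.1 q.1.2)).trace.re = n} ≠ 0) :
    Tendsto (fun β : ℝ => coldDefect ρ β L) atTop
      (𝓝 (1 - (Measure.pi fun _ : FinTorusSite L L L (2 * (L / 4)) × Fin 4 => haarProbability G).real
          {U : FinTorusSite L L L (2 * (L / 4)) × Fin 4 → G |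
            ∀ (x : FinTorusSite L L L (2 * (L / 4))) (q : {q : Fin 4 × Fin 4 // q.1 < q.2}),
              (ρ (finTorusPlaquette U x q.1.1 q.1.2)).trace.re = n} /
        (Measure.pi fun _ : FinTorusSite L L L (L / 4) × Fin 4 => haarProbability G).real
          {U : FinTorusSite L L L (L / 4) × Fin 4 → G |
            ∀ (x : FinTorusSite L L L (L / 4)) (q : {q : Fin 4 × Fin 4 // q.1 < q.2}),
              (ρ (finTorusPlaquette U x q.1.1 q.1.2)).trace.re = n} ^ 2)) := by
  unfold coldDefect
  exact tendsto_const_nhds.sub ((tendsto_wilsonFinTorusPartition_atTop ρ hρ L L L (2 * (L / 4))).div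
    ((tendsto_wilsonFinTorusPartition_atTop ρ hρ L L L (L / 4)).pow 2) (pow_ne_zero 2 hpos))

/-- **The fixed-box purity test fails beyond the freezing limit.**  If `θ < 1 − Haar(Flat₂)/Haar(Flat₁)²` (short-box flat mass positive),
then for all sufficiently large `β` the cold box `L³ × ⌊L/4⌋` is NOT `θ`-pure: `θ < coldDefect ρ β L`. -/
theorem eventually_lt_coldDefect_of_lt_freezingLimit (hρ : Continuous ρ) (L : ℕ) {θ : ℝ}
    (hpos : (Measure.pi fun _ : FinTorusSite L L L (L / 4) × Fin 4 => haarProbability G).real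
        {U : FinTorusSite L L L (L / 4) × Fin 4 → G |
          ∀ (x : FinTorusSite L L L (L / 4)) (q : {q : Fin 4 × Fin 4 // q.1 < q.2}),
            (ρ (finTorusPlaquette U x q.1.1 q.1.2)).trace.re = n} ≠ 0)
    (hθ : θ < 1 - (Measure.pi fun _ : FinTorusSite L L L (2 * (L / 4)) × Fin 4 => haarProbability G).real
          {U : FinTorusSite L L L (2 * (L / 4)) × Fin 4 → G |
            ∀ (x : FinTorusSite L L L (2 * (L / 4))) (q : {q : Fin 4 × Fin 4 // q.1 < q.2}),
              (ρ (finTorusPlaquette U x q.1.1 q.1.2)).trace.re = n} /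
        (Measure.pi fun _ : FinTorusSite L L L (L / 4) × Fin 4 => haarProbability G).real
          {U : FinTorusSite L L L (L / 4) × Fin 4 → G |
            ∀ (x : FinTorusSite L L L (L / 4)) (q : {q : Fin 4 × Fin 4 // q.1 < q.2}),
              (ρ (finTorusPlaquette U x q.1.1 q.1.2)).trace.re = n} ^ 2) :
    ∀ᶠ β : ℝ in atTop, θ < coldDefect ρ β L :=
  (tendsto_coldDefect_atTop ρ hρ L hpos).eventually (eventually_gt_nhds hθ)

/-! ## §3 Finite gauge groups: the flat set has positive mass, so the freezing limit of THE NUMBER's currency always exists -/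

section Finite

variable [Fintype G] [DiscreteTopology G]

omit [SecondCountableTopology G] in
/-- For a finite (discrete) gauge group the product Haar measure gives every gauge field on the `Fin`-torus the mass `|G|^{−#links}`
(tree `haarProbability_singleton`). -/
theorem pi_haarProbability_singleton {n₀ n₁ n₂ n₃ : ℕ} (U : FinTorusSite n₀ n₁ n₂ n₃ × Fin 4 → G) :
    (Measure.pi fun _ : FinTorusSite n₀ n₁ n₂ n₃ × Fin 4 => haarProbability G) {U} =
      (((Fintype.card G : ENNReal))⁻¹) ^ Fintype.card (FinTorusSite n₀ n₁ n₂ n₃ × Fin 4) := by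
  haveI : DiscreteMeasurableSpace G := discreteMeasurableSpace_of_borel
  rw [← Set.univ_pi_singleton U, Measure.pi_pi]
  simp only [haarProbability_singleton, Finset.prod_const, Finset.card_univ]

omit [SecondCountableTopology G] in
/-- For a finite (discrete) gauge group, the product-Haar mass of ANY set of gauge fields on the `Fin`-torus is
`#set / |G|^{#links}` (counting measure normalised). -/
theorem measureReal_pi_haarProbability_eq_card {n₀ n₁ n₂ n₃ : ℕ} (s : Set (FinTorusSite n₀ n₁ n₂ n₃ × Fin 4 → G)) :
    (Measure.pi fun _ : FinTorusSite n₀ n₁ n₂ n₃ × Fin 4 => haarProbability G).real s =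
      (Nat.card s : ℝ) / (Fintype.card G : ℝ) ^ Fintype.card (FinTorusSite n₀ n₁ n₂ n₃ × Fin 4) := by
  classical
  haveI : DiscreteMeasurableSpace G := discreteMeasurableSpace_of_borel
  set π : Measure (FinTorusSite n₀ n₁ n₂ n₃ × Fin 4 → G) :=
    Measure.pi fun _ : FinTorusSite n₀ n₁ n₂ n₃ × Fin 4 => haarProbability G with hπ
  have hsingle : ∀ U : FinTorusSite n₀ n₁ n₂ n₃ × Fin 4 → G,
      π.real {U} = ((Fintype.card G : ℝ) ^ Fintype.card (FinTorusSite n₀ n₁ n₂ n₃ × Fin 4))⁻¹ := by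
    intro U
    rw [measureReal_def, hπ, pi_haarProbability_singleton U, ENNReal.toReal_pow, ENNReal.toReal_inv,
      ENNReal.toReal_natCast, inv_pow]
  obtain ⟨t, rfl⟩ : ∃ t : Finset (FinTorusSite n₀ n₁ n₂ n₃ × Fin 4 → G), s = ↑t := ⟨s.toFinite.toFinset, by simp⟩
  have hcard : (Nat.card (↑t : Set (FinTorusSite n₀ n₁ n₂ n₃ × Fin 4 → G)) : ℝ) = t.card := by
    rw [Nat.card_eq_fintype_card]; simp
  rw [hcard, ← sum_measureReal_singleton, Finset.sum_congr rfl fun U _ => hsingle U, Finset.sum_const,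
    nsmul_eq_mul, div_eq_mul_inv]

omit [MeasurableSpace G] [BorelSpace G] [SecondCountableTopology G] [Fintype G] [DiscreteTopology G]
  [TopologicalSpace G] [IsTopologicalGroup G] [CompactSpace G] in
/-- The trivial gauge field is flat (every group, every representation). -/
theorem one_mem_flat {n₀ n₁ n₂ n₃ : ℕ} :
    (1 : FinTorusSite n₀ n₁ n₂ n₃ × Fin 4 → G) ∈ {U : FinTorusSite n₀ n₁ n₂ n₃ × Fin 4 → G |
      ∀ (x : FinTorusSite n₀ n₁ n₂ n₃) (q : {q : Fin 4 × Fin 4 // q.1 < q.2}),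
        (ρ (finTorusPlaquette U x q.1.1 q.1.2)).trace.re = n} := by
  intro x q
  simp [finTorusPlaquette, Matrix.trace_one]

omit [SecondCountableTopology G] in
/-- For a finite (discrete) gauge group the flat set of every `Fin`-torus has POSITIVE product-Haar mass (it contains the trivial field). -/
theorem measureReal_flat_pos {n₀ n₁ n₂ n₃ : ℕ} :
    0 < (Measure.pi fun _ : FinTorusSite n₀ n₁ n₂ n₃ × Fin 4 => haarProbability G).real
        {U : FinTorusSite n₀ n₁ n₂ n₃ × Fin 4 → G |
          ∀ (x : FinTorusSite n₀ n₁ n₂ n₃) (q : {q : Fin 4 × Fin 4 // q.1 < q.2}),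
            (ρ (finTorusPlaquette U x q.1.1 q.1.2)).trace.re = n} := by
  rw [measureReal_pi_haarProbability_eq_card]
  have hG : 0 < (Fintype.card G : ℝ) := by exact_mod_cast Fintype.card_pos
  refine div_pos ?_ (pow_pos hG _)
  have hne : Nat.card {U : FinTorusSite n₀ n₁ n₂ n₃ × Fin 4 → G |
      ∀ (x : FinTorusSite n₀ n₁ n₂ n₃) (q : {q : Fin 4 × Fin 4 // q.1 < q.2}),
        (ρ (finTorusPlaquette U x q.1.1 q.1.2)).trace.re = n} ≠ 0 := by
    rw [Nat.card_ne_zero]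
    exact ⟨⟨⟨1, one_mem_flat ρ⟩⟩, Set.toFinite _⟩
  exact_mod_cast Nat.pos_of_ne_zero hne

/-- **Finite gauge groups: THE NUMBER's currency freezes at every fixed box.**  For a finite (discrete) gauge group `G`, every matrix
representation `ρ` and every `L`: `coldDefect ρ β L → 1 − Haar(Flat(L³×2⌊L/4⌋))/Haar(Flat(L³×⌊L/4⌋))²` as `β → ∞` — no hypothesis
(the short-box flat mass is positive, `measureReal_flat_pos`).  With `measureReal_pi_haarProbability_eq_card` the limit is the counting
ratio `1 − (#Flat₂ · |G|^{#links₁})… ` of flat lattice gauge fields ('t Hooft flux sectors × gauge orbits). -/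
theorem tendsto_coldDefect_atTop_of_finite (L : ℕ) :
    Tendsto (fun β : ℝ => coldDefect ρ β L) atTop
      (𝓝 (1 - (Measure.pi fun _ : FinTorusSite L L L (2 * (L / 4)) × Fin 4 => haarProbability G).real
          {U : FinTorusSite L L L (2 * (L / 4)) × Fin 4 → G |
            ∀ (x : FinTorusSite L L L (2 * (L / 4))) (q : {q : Fin 4 × Fin 4 // q.1 < q.2}),
              (ρ (finTorusPlaquette U x q.1.1 q.1.2)).trace.re = n} /
        (Measure.pi fun _ : FinTorusSite L L L (L / 4) × Fin 4 => haarProbability G).real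
          {U : FinTorusSite L L L (L / 4) × Fin 4 → G |
            ∀ (x : FinTorusSite L L L (L / 4)) (q : {q : Fin 4 × Fin 4 // q.1 < q.2}),
              (ρ (finTorusPlaquette U x q.1.1 q.1.2)).trace.re = n} ^ 2)) :=
  tendsto_coldDefect_atTop ρ continuous_of_discreteTopology L (measureReal_flat_pos ρ).ne'

/-- **Finite gauge groups: the fixed-box purity test fails beyond the counting ratio.**  For finite (discrete) `G`, every `ρ`, every box
`L` and every tolerance `θ < 1 − Haar(Flat₂)/Haar(Flat₁)²`: for all sufficiently large `β`, `θ < coldDefect ρ β L`. -/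
theorem eventually_lt_coldDefect_of_finite (L : ℕ) {θ : ℝ}
    (hθ : θ < 1 - (Measure.pi fun _ : FinTorusSite L L L (2 * (L / 4)) × Fin 4 => haarProbability G).real
          {U : FinTorusSite L L L (2 * (L / 4)) × Fin 4 → G |
            ∀ (x : FinTorusSite L L L (2 * (L / 4))) (q : {q : Fin 4 × Fin 4 // q.1 < q.2}),
              (ρ (finTorusPlaquette U x q.1.1 q.1.2)).trace.re = n} /
        (Measure.pi fun _ : FinTorusSite L L L (L / 4) × Fin 4 => haarProbability G).real
          {U : FinTorusSite L L L (L / 4) × Fin 4 → G |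
            ∀ (x : FinTorusSite L L L (L / 4)) (q : {q : Fin 4 × Fin 4 // q.1 < q.2}),
              (ρ (finTorusPlaquette U x q.1.1 q.1.2)).trace.re = n} ^ 2) :
    ∀ᶠ β : ℝ in atTop, θ < coldDefect ρ β L :=
  (tendsto_coldDefect_atTop_of_finite ρ L).eventually (eventually_gt_nhds hθ)

end Finite

end Summit.QuantumFields.YangMills.Cruxes.IR.FreezingLimit

end
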